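import Literature.Analysis.FluidPDE.OnsagerBDSVEnergyCrossTerm
import Literature.Analysis.FluidPDE.OnsagerBDSVEnergyCorrectorHolds
import Literature.Analysis.FluidPDE.OnsagerBDSVEnergyPrincipalProofs
import HarnessLib

/-!
# The BDSV energy estimate (Prop. 6.2): discharge

Buckmaster–De Lellis–Székelyhidi–Vicol (BDSV), *Onsager's conjecture for admissible weak
solutions*, Comm. Pure Appl. Math. **72** (2019) 229–274 = arXiv:1701.08678, Prop. 6.2
(arXiv (2.24c) = (6.13)):

> "The energy of `v_{q+1}` satisfies the following estimate:
> `|e(t) - ∫_{T³} |v_{q+1}|² dx - δ_{q+2}/2| ≲ δ_q^{1/2} δ_{q+1}^{1/2} λ_q^{1+2α} / λ_{q+1}`."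

The named fact `BDSV.energyEstimate` (F₇ of `OnsagerBDSVPerturbation.lean`) was reduced in
`OnsagerBDSVEnergy.lean` (`BDSV.energyEstimate_of_parts`, the printed proof of Prop. 6.2: the
energy identity `e - ∫|v_{q+1}|² - δ_{q+2}/2 = (3ρ_q - ∫|w_o|²) - 2∫ w_{q+1}·v̄_q - ∫(2w_o·w_c + |w_c|²)`
plus the comparison of the three scales) to its three printed estimates, each of which is now
proved in the tree:

* G₁ the cross term `|∫ w_{q+1}·v̄_q| ≲ δ_q^{1/2} δ_{q+1}^{1/2} λ_q λ_{q+1}⁻¹`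
  (`BDSV.energy_crossTerm_holds`, `OnsagerBDSVEnergyCrossTerm.lean`);
* G₂ the corrector terms `|∫ 2w_o·w_c + |w_c|²| ≲ δ_{q+1} ℓ⁻¹ λ_{q+1}⁻¹`
  (`BDSV.energy_correctorTerm_holds`, `OnsagerBDSVEnergyCorrectorHolds.lean`);
* G₃ the principal term `|∫|w_o|² - 3ρ_q| ≲ δ_{q+1} δ_q^{1/2} λ_q λ_{q+1}⁻¹`
  (`BDSV.energy_principalTerm_holds`, `OnsagerBDSVEnergyPrincipalProofs.lean`).

This file assembles them: `BDSV.energyEstimate_holds`. It is one of the three inputs of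
`BDSV.perturbationStage_of_three` (`OnsagerBDSVPerturbationAssembly.lean`), hence of
`BDSV.mainIteration_of_threeStages` (`OnsagerBDSVThreeStagesProofs.lean`, Prop. 2.1).

## References

* T. Buckmaster, C. De Lellis, L. Székelyhidi Jr., V. Vicol, *Onsager's conjecture for admissible
  weak solutions*, Comm. Pure Appl. Math. 72 (2019) 229–274 = arXiv:1701.08678, §6.2, Prop. 6.2
  and its proof. [cite: BuckmasterEtAl2018, Prop. 6.2]
-/

namespace Literature.Analysis.FluidPDE

namespace BDSV

/-- **Prop. 6.2 of BDSV, discharged** (`|e(t) - ∫|v_{q+1}|² - δ_{q+2}/2| ≲ δ_q^{1/2}δ_{q+1}^{1/2}λ_q^{1+2α}λ_{q+1}⁻¹`,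
as transcribed by the named fact `BDSV.energyEstimate`): the proved assembly
`BDSV.energyEstimate_of_parts` (proof of Prop. 6.2) applied to the three proved estimates
`BDSV.energy_crossTerm_holds` (G₁), `BDSV.energy_correctorTerm_holds` (G₂),
`BDSV.energy_principalTerm_holds` (G₃). [cite: BuckmasterEtAl2018, Prop. 6.2] -/
theorem energyEstimate_holds : energyEstimate :=
  energyEstimate_of_parts energy_crossTerm_holds energy_correctorTerm_holds
    energy_principalTerm_holds

end BDSV

end Literature.Analysis.FluidPDE
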